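import Summits.QuantumFields.BalabanUV.Beta.FP.TorusOneShotColumnGaugeProjG
import Summits.QuantumFields.BalabanUV.Beta.FP.TowerKernelLawNamedB

/-!
# `BalabanUV.Beta.FP.TorusOneShotColumnGaugeProjSym` — road «FP» for binder row D1, ROUTE T (β1), J-RISK-1 LOCATED (Q-FP-39-1), THE RECORD AT THE END WRAPPER's PINS:
# **AT THE (0.4)-SYMMETRISED COMPOSITE TOWER OF RECORD (the END wrapper `StepRecursionFeedNestedNamedB`'s literal objects) the one-shot N column IS the gauge
# projection of the nested direction — NO side letter left**: `XN₁₂·(v,0) = hv v − W₀·((P·W₀)⁻¹·(P·hv v))`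

WHAT.  `TorusOneShotColumnGaugeProjG.XN_toBlocks₁₂_mulVec_eq_gaugeProj_G` at `Q := QSym Lc`, `K ℓ _ := bhKStepSh d Lc (Dsh Lc) ℓ`, roots `ctrOff (d+1) Lc` at every
storey — the END wrapper's pins (`hH₀ hQ₁₀ hτ₁ hτ₂ hQ₂₀ hW₀ hP`, the coarse slot presentation `pμ′ mμ′ hfμ′ hcoarse′`, the namings `hI hS h𝔔₀`, the nested
direction `hhv`, the one-shot right inverse `hXN`) — with EVERY brick input of the `-G` door DISCHARGED BY NAME exactly as `NestedStepLawTorusCompositeOneShotTopSymB`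
and `TowerKernelLawNamedB` discharge them for #21-GB: `hH₀t` (leaf-05 `torus_H₀_transpose_comb`), `hone ∕ hId` (leaf-05 `torus_h1_comb ∕ hId_comb`), `htop`
(leaf-05 `torus_isUnit_det_kkt_combRows_comb`), `hSL` (leaf-06 G-1 `det_nestedSliceSym_mul_towerGen_ne_zero` fed leaf-02 R-20), `c0` (leaf-02 R-20
`compRowsSym_mul_towerGen_succ`), `hTW` (leaf-06 G-2 `torus_hTW_oneShot_towerSym`), `d0` (leaf-02 `QtopSym_mul_smul_tgrad_res`), `a0` (#20 `torus_a0_tower` through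
`bhKStepSh_Dsh_inl_inl_eq_bhKStepAt`).  So at the wrapper (`M′ := fine Lc (Mc B)`, `lev i := n+1−i`, `κ := pbox (Mc B) × Fin 4`, `pμ′ a := coarsePt (Mc B) Lc a.1`,
`mμ′ a := a.2`) the identity holds for every depth `n`, box `B` and top source `v` with NO hypothesis beyond the wrapper's own pins and namings.
[folklore] ONE instantiation BY NAME; no `def`, no `def … : Prop`, nothing cited, 0 sorry.  WHAT THIS IS NOT: not `lv`'s instantiation, not (J-X), not (J-Λ); no
row of the END wrapper discharged; nothing of Bałaban's asserted, valued or discharged; 0 estimates; 0∕4 row-D1 binders (hW, hR, D1Tel, D1Rep); ROOT M‴ p325680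
untouched; NOT (C1), NOT (L2′), NOT (T-ID), NOT SDF, NOT D1, NOT BetaPertH, NOT continuum, NOT Clay.

HONEST DEPENDENCY (page 1, mandatory): continuum YM on T⁴ ⇐ BetaPertH ∧ nine spine estimates (0/9 proved); BetaPertH ⇐ (D1) ∧ (D4) ∧ CAP+tail;
G-an2-4 gates asym, D1 and NE2/3/4.  HONEST FRAMING (cell contract, verbatim): «discharging `BetaPertH` makes Bałaban's UV stability UNCONDITIONAL —
a real constructive-QFT result; it is NOT the continuum limit and NOT the Clay problem.»  ABSOLUTE RULE (cell charter, verbatim): «No internally-minted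
statement may enter as a cited fact. Every hypothesis is either kernel-proved in this package or a verbatim quotation of a PUBLISHED theorem with page
reference. The manuscript(s) under audit are NOT citable for their own disputed steps — they are the thing under adjudication; programme-internal
(2001/route/tribunal) claims are never citable.»  Road «FP» OWNER, b2b-balaban-beta-d1-p3 gen 39, 2026-08-27.  No existing file touched.
-/

noncomputable section

namespace Summit.QuantumFields.BalabanUV.Beta.FP.TorusOneShotColumnGaugeProjSym

open Matrix Finset
open Literature.Probability.LatticeModels (Torus.proj)
open Literature.MathematicalPhysics.QuantumFieldTheory.Balaban1983to89
open Literature.MathematicalPhysics.QuantumFieldTheory.Balaban1983to89.Beta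
open Literature.MathematicalPhysics.QuantumFieldTheory.Balaban1983to89.Beta.Composition (kkt)
open Literature.MathematicalPhysics.QuantumFieldTheory.Balaban1983to89.Beta.CompositionSingular (effForm minOp)
open B5Prop11Plancherel (fine)
open B6Lemma24Torus (pbox)
open AffineAveraging (Site box toSite)
open AveragingContoursRooted (ctrOff ctrOff_mem_box)
open OneStepResolventKernel (Fib)
open Summit.QuantumFields.BalabanUV.Beta.SymShiftedSpread (bhKStepSh)
open Summit.QuantumFields.BalabanUV.Beta.BorderedHessian (bhKStepAt)
open Summit.QuantumFields.BalabanUV.Beta.DshAn1 (Dsh)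
open Summit.QuantumFields.BalabanUV.Beta.FP.KernelPeriodisationFib (Idx perF perF_apply perZ_apply)
open Summit.QuantumFields.BalabanUV.Beta.FP.TorusCombRows (Res)
open Summit.QuantumFields.BalabanUV.Beta.FP.TorusCompositeObjects (towerTorus NParam combF bigP towerGen)
open Summit.QuantumFields.BalabanUV.Beta.FP.TorusCompositeObjectsG (QSym compRowsSym)
open Summit.QuantumFields.BalabanUV.Beta.FP.TorusCompositeSliceG (det_nestedSliceSym_mul_towerGen_ne_zero)
open Summit.QuantumFields.BalabanUV.Beta.FP.TorusCompositeSliceOneShotG (torus_hTW_oneShot_towerSym)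
open Summit.QuantumFields.BalabanUV.Beta.FP.TorusCompositeCovarianceSym (compRowsSym_mul_towerGen_succ QtopSym_mul_smul_tgrad_res)
open Summit.QuantumFields.BalabanUV.Beta.FP.RelInvPeriodisedCombTorusLetters (torus_h1_comb hId_comb torus_H₀_transpose_comb)
open Summit.QuantumFields.BalabanUV.Beta.FP.RelInvPeriodisedCombRecord (torus_isUnit_det_kkt_combRows_comb)
open Summit.QuantumFields.BalabanUV.Beta.FP.NestedStepLawTorusComposite (dvd_towerTorus_succ)
open Summit.QuantumFields.BalabanUV.Beta.FP.NestedStepLawTorusCompositeOneShot (torus_a0_tower)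
open Summit.QuantumFields.BalabanUV.Beta.FP.NestedStepLawTorusCompositeOneShotTopSym (bhKStepSh_Dsh_inl_inl_eq_bhKStepAt)
open Summit.QuantumFields.BalabanUV.Beta.FP.NestedStepLawTorusInstance (dvd_fine)
open Summit.QuantumFields.BalabanUV.Beta.GAN24.FineReadoutCauchyFrame (toSite_mem_range)
open Summit.QuantumFields.BalabanUV.Beta.FP.TorusOneShotColumnGaugeProjG (XN_toBlocks₁₂_mulVec_eq_gaugeProj_G)

variable {d : ℕ}

section RecordSym

variable (M' : Fin (d + 1) → ℕ) [∀ μ, NeZero (M' μ)] (Lc : ℕ) [NeZero Lc] (lev : ℕ → ℕ) (n : ℕ)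

set_option synthInstance.maxSize 1024 in
/-- [folklore] **`XN_toBlocks₁₂_mulVec_eq_gaugeProj_sym` — THE ONE-SHOT N COLUMN IS THE GAUGE PROJECTION OF THE NESTED DIRECTION AT THE END WRAPPER's PINS, NO SIDE
LETTER LEFT.**  Binders = `NestedStepLawTorusCompositeOneShotTopSymB`'s pins (`hrs hlev hM′`, the slot presentation `pμ′ mμ′ hfμ′ hcoarse′`, `hH₀ hQ₁₀ hτ₁ hτ₂ hQ₂₀
hW₀ hP`) and the wrapper's namings `h𝔔₀ hI hS hhv hXN` VERBATIM.  CONCLUSION: `XN.toBlocks₁₂ · (v, 0) = hv v − W₀·((P·W₀)⁻¹·(P·hv v))` for every top source `v`. -/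
theorem XN_toBlocks₁₂_mulVec_eq_gaugeProj_sym (hrs : ∀ _k : ℕ, ctrOff (d + 1) Lc ∈ box (d + 1) Lc)
    (hlev : ∀ i, i ≤ n → lev i = lev (i + 1) + 1) (hM' : ∀ i, Lc ∣ M' i)
    {κ : Type*} [Fintype κ] [DecidableEq κ] (pμ' : κ → ↥(pbox M')) (mμ' : κ → Fin (d + 1))
    (hfμ' : Function.Injective (fun a : κ => ((pμ' a, Sum.inr (mμ' a)) : Idx M' (Fib d))))
    (hcoarse' : ∀ (s : ↥(pbox M')) (m : Fin (d + 1)),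
      ((s, Sum.inr m) : Idx M' (Fib d)) ∈ Set.range (fun a : κ => ((pμ' a, Sum.inr (mμ' a)) : Idx M' (Fib d))) ↔ Torus.proj Lc (s : Site (d + 1)) = 0)
    {H₀ : Matrix (↥(pbox (towerTorus Lc M' (n + 1))) × Fin (d + 1)) (↥(pbox (towerTorus Lc M' (n + 1))) × Fin (d + 1)) ℝ}
    {Q₁₀ : Matrix (↥(pbox M') × Fin (d + 1)) (↥(pbox (towerTorus Lc M' (n + 1))) × Fin (d + 1)) ℝ}
    {τ₁ : Matrix (NParam Lc (fine Lc M') (fun k => (fun _ : ℕ => ctrOff (d + 1) Lc) (k + 1)) n) (↥(pbox (towerTorus Lc M' (n + 1))) × Fin (d + 1)) ℝ}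
    (hH₀ : H₀ = (perF (towerTorus Lc M' (n + 1)) (bhKStepSh d Lc (Dsh Lc) (lev (n + 1)))).submatrix
        (fun b : ↥(pbox (towerTorus Lc M' (n + 1))) × Fin (d + 1) => ((b.1, Sum.inl b.2) : Idx (towerTorus Lc M' (n + 1)) (Fib d)))
        (fun b : ↥(pbox (towerTorus Lc M' (n + 1))) × Fin (d + 1) => ((b.1, Sum.inl b.2) : Idx (towerTorus Lc M' (n + 1)) (Fib d))))
    (hQ₁₀ : Q₁₀ = compRowsSym Lc M' lev (fun _ : ℕ => ctrOff (d + 1) Lc) (n + 1))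
    (hτ₁ : τ₁ = bigP Lc (fine Lc M') (fun k => (fun _ : ℕ => ctrOff (d + 1) Lc) (k + 1)) (fun k => toSite_mem_range (hrs (k + 1))) n)
    {τ₂ : Matrix (Res (toSite (ctrOff (d + 1) Lc)) Lc M') (↥(pbox M') × Fin (d + 1)) ℝ} (hτ₂ : τ₂ = combF Lc M' ((fun _ : ℕ => ctrOff (d + 1) Lc) 0))
    {Q₂₀ : Matrix κ (↥(pbox M') × Fin (d + 1)) ℝ}
    (hQ₂₀ : Q₂₀ = (perF M' (bhKStepSh d Lc (Dsh Lc) (lev 0))).submatrix (fun a : κ => ((pμ' a, Sum.inr (mμ' a)) : Idx M' (Fib d)))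
        (fun b : ↥(pbox M') × Fin (d + 1) => ((b.1, Sum.inl b.2) : Idx M' (Fib d))))
    {W₀ : Matrix (↥(pbox (towerTorus Lc M' (n + 1))) × Fin (d + 1)) (NParam Lc M' (fun _ : ℕ => ctrOff (d + 1) Lc) (n + 1)) ℝ}
    (hW₀ : W₀ = towerGen Lc M' (fun _ : ℕ => ctrOff (d + 1) Lc) (n + 1))
    {P : Matrix (NParam Lc M' (fun _ : ℕ => ctrOff (d + 1) Lc) (n + 1)) (↥(pbox (towerTorus Lc M' (n + 1))) × Fin (d + 1)) ℝ}
    (hP : P = bigP Lc M' (fun _ : ℕ => ctrOff (d + 1) Lc) (fun k => toSite_mem_range (hrs k)) (n + 1))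
    {𝔔₀ : Matrix κ (↥(pbox (towerTorus Lc M' (n + 1))) × Fin (d + 1)) ℝ} (h𝔔₀ : Q₂₀ * Q₁₀ = 𝔔₀)
    {I : Matrix (↥(pbox (towerTorus Lc M' (n + 1))) × Fin (d + 1))
      ((↥(pbox M') × Fin (d + 1)) ⊕ NParam Lc (fine Lc M') (fun k => (fun _ : ℕ => ctrOff (d + 1) Lc) (k + 1)) n) ℝ}
    {S : Matrix ((↥(pbox M') × Fin (d + 1)) ⊕ NParam Lc (fine Lc M') (fun k => (fun _ : ℕ => ctrOff (d + 1) Lc) (k + 1)) n)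
      ((↥(pbox M') × Fin (d + 1)) ⊕ NParam Lc (fine Lc M') (fun k => (fun _ : ℕ => ctrOff (d + 1) Lc) (k + 1)) n) ℝ}
    (hI : minOp H₀ (fromRows Q₁₀ τ₁) = I) (hS : effForm H₀ (fromRows Q₁₀ τ₁) = S)
    {hv : (κ → ℝ) → ((↥(pbox (towerTorus Lc M' (n + 1))) × Fin (d + 1)) → ℝ)}
    (hhv : ∀ v, hv v = I *ᵥ Sum.elim (minOp S.toBlocks₁₁ (fromRows Q₂₀ τ₂) *ᵥ Sum.elim v 0) 0)
    {XN : Matrix ((↥(pbox (towerTorus Lc M' (n + 1))) × Fin (d + 1)) ⊕ (κ ⊕ NParam Lc M' (fun _ : ℕ => ctrOff (d + 1) Lc) (n + 1)))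
      ((↥(pbox (towerTorus Lc M' (n + 1))) × Fin (d + 1)) ⊕ (κ ⊕ NParam Lc M' (fun _ : ℕ => ctrOff (d + 1) Lc) (n + 1))) ℝ}
    (hXN : kkt H₀ (fromRows 𝔔₀ P) * XN = 1) (v : κ → ℝ) :
    XN.toBlocks₁₂ *ᵥ Sum.elim v 0 = hv v - W₀ *ᵥ ((P * W₀)⁻¹ *ᵥ (P *ᵥ hv v)) := by
  have hc : ctrOff (d + 1) Lc ∈ box (d + 1) Lc := hrs 0
  -- `a0` in #20's `bhKStepAt` spelling (the `Dsh` shift does not touch the field block)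
  have hH₀' : H₀ = (perF (towerTorus Lc M' (n + 1)) (bhKStepAt d (toSite (ctrOff (d + 1) Lc)) Lc (lev (n + 1)))).submatrix
      (fun b : ↥(pbox (towerTorus Lc M' (n + 1))) × Fin (d + 1) => ((b.1, Sum.inl b.2) : Idx (towerTorus Lc M' (n + 1)) (Fib d)))
      (fun b : ↥(pbox (towerTorus Lc M' (n + 1))) × Fin (d + 1) => ((b.1, Sum.inl b.2) : Idx (towerTorus Lc M' (n + 1)) (Fib d))) := by
    rw [hH₀]; ext p q
    simp only [Matrix.submatrix_apply, perF_apply, perZ_apply]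
    exact tsum_congr fun m => bhKStepSh_Dsh_inl_inl_eq_bhKStepAt Lc (toSite (ctrOff (d + 1) Lc)) (lev (n + 1)) _ _ _ _
  exact XN_toBlocks₁₂_mulVec_eq_gaugeProj_G M' Lc lev (fun _ : ℕ => ctrOff (d + 1) Lc) n (QSym Lc) (fun ℓ _ => bhKStepSh d Lc (Dsh Lc) ℓ) hrs hlev hM'
    hH₀ hQ₁₀ hτ₁
    (by rw [hH₀]; exact torus_H₀_transpose_comb (towerTorus Lc M' (n + 1)) (dvd_towerTorus_succ (Lc := Lc) M' n) (lev (n + 1)))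
    (fun k T _ => torus_h1_comb T (lev k)) (fun k T _ _ => hId_comb T (lev k))
    (det_nestedSliceSym_mul_towerGen_ne_zero Lc (compRowsSym_mul_towerGen_succ Lc hc) n (fine Lc M') (fun k => lev (k + 1)) (dvd_fine M'))
    Q₂₀
    (by
      rw [hQ₂₀, hτ₂]
      exact (torus_isUnit_det_kkt_combRows_comb M' hM' (lev 0) _ hfμ' (fun a => ⟨mμ' a, rfl⟩) hcoarse').ne_zero)
    hW₀ hP
    (by rw [hQ₁₀, hW₀]; exact compRowsSym_mul_towerGen_succ Lc hc n M' lev)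
    (torus_hTW_oneShot_towerSym M' Lc lev (fun _ : ℕ => ctrOff (d + 1) Lc) n hrs hM' (compRowsSym_mul_towerGen_succ Lc hc n M' lev) hQ₁₀ hτ₁ hτ₂ hW₀)
    (by rw [hQ₂₀]; exact QtopSym_mul_smul_tgrad_res Lc M' hM' (lev 0) _ pμ' mμ')
    (torus_a0_tower Lc M' lev (fun _ : ℕ => ctrOff (d + 1) Lc) n hrs hH₀' hW₀)
    h𝔔₀ hI hS hhv hXN v

end RecordSym

end Summit.QuantumFields.BalabanUV.Beta.FP.TorusOneShotColumnGaugeProjSym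

end
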